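import Literature.Computability.QuantumComplexity.EvenSingularValueTransformation
import Literature.Computability.QuantumComplexity.ApproximatingSingularValues
import Literature.LinearAlgebra.Matrix.HermitianCfcDiagonalForm
import HarnessLib

/-!
# Dequantized principal component analysis for low-rank matrices (CGLLTW, Corollary 4.8):
# the eigenvalue filter, the rank-one read-out and the error chain, on top of the tree's even SVT

Chia, Gilyén, Li, Lin, Tang, Wang, *Sampling-based sublinear low-rank matrix arithmetic framework
for dequantizing quantum machine learning*, J. ACM 69(5):33 (2022) = arXiv:1910.06151 (held text,
§4.3 "Principal component analysis", p. 25 L15 – p. 26 L58).  The dequantization of quantum PCA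
(Lloyd–Mohseni–Rebentrost 2014) in the low-rank setting, "as first noted in" Tang,
arXiv:1811.00414:

> **Problem 4.7 (PCA for low-rank matrices).** Given a matrix `SQ(X) ∈ ℂ^{m×n}` such that `X†X`
> has top `k` eigenvalues `{λ_i}_{i=1}^k` and eigenvectors `{v_i}_{i=1}^k`, with probability
> `≥ 1−δ`, compute eigenvalue estimates `{λ̂_i}_{i=1}^k` such that
> `Σ_{i=1}^k |λ̂_i − λ_i| ≤ ε tr(X†X)` and eigenvectors `{SQ_φ(v̂_i)}_{i=1}^k` such that
> `‖v̂_i − v_i‖ ≤ ε` for all `i`.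
> […] `K := tr(X†X)/λ_k ≥ k` and `η := min_{i∈[k]} |λ_i − λ_{i+1}|/‖X‖²`.
>
> **Corollary 4.8.** For `0 < ε ≲ η‖X‖²/‖X‖_F²`, we can solve (Problem 4.7) in
> `Õ((‖X‖_F⁶/(λ_k²‖X‖²)) η⁻⁶ ε⁻⁶ log³(k/δ))` time to get `SQ_φ(v̂_i)` where
> `sq_φ(v̂_i) = Õ((‖X‖_F⁴/(λ_i‖X‖²)) η⁻² ε⁻² log²(1/δ))`.
>
> *Proof.* […] consider `C := SXT` as described in (thm:evenSing) […]. Consider computing the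
> eigenvalues of `CC†`; denote the `i`th eigenvalue `λ̂_i`.  […] by (prop:appr-svs) […]
> `√(Σ_{i=1}^{min(m,n)} (λ̂_i − λ_i)²) ≤ (ε√λ_k/(8‖X‖_F))‖X‖_F²`.  These `λ̂_i`'s for `i ∈ [k]` have
> the desired property for eigenvalue estimates:
> `Σ_{i=1}^k |λ̂_i − λ_i| ≤ √k √(Σ_{i=1}^k (λ̂_i − λ_i)²) ≤ ε√k λ_k‖X‖_F ≤ ε‖X‖_F²`.  This
> bound also implies that, for all `i`, `|λ̂_i − λ_i| ≤ (η/8)‖X‖²`.  Next, consider the eigenvalue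
> transformations `f_i` for `i ∈ [k]` […] a function that is one when `|x − λ̂_i| ≤ (η/8)‖X‖²`,
> zero when `|x − λ̂_i| ≥ (η/4)‖X‖²`, and interpolates [linearly] between them otherwise.  From
> the eigenvalue gap and the aforementioned bound `|λ̂_i − λ_i| ≤ (η/8)‖X‖²`, we can conclude
> that `f_i(X†X) = v_iv_i†` exactly.  Further, by (thm:evenSing), we can conclude that
> `R†\bar f_i(CC†)R` approximates `v_iv_i†`, with `C, R` the exact approximations used to
> estimate singular values. […] (note `f_i(0) = 0`) […] Further, `f_i` is chosen with respect to
> `λ̂_i` such that `R†\bar f_i(CC†)R` is rank one, since `CC†` has one eigenvalue between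
> `λ̂_i − (η/4)‖X‖²` and `λ̂_i + (η/4)‖X‖²`.  Thus, this approximation is an outer product,
> `R†\bar f_i(CC†)R = v̂_iv̂_i†`, and we take the corresponding vector to be our eigenvector
> estimate: `‖v̂_i‖ ≤ √(1+ε/2) ≤ 1+ε/4`, so
> `ε/2 ≥ ‖(v̂_iv̂_i† − v_iv_i†)v_i‖ = ‖⟨v̂_i,v_i⟩v̂_i − v_i‖`
> `≥ ‖v̂_i − v_i‖ − (⟨v̂_i,v_i⟩ − 1)‖v̂_i‖`
> `≥ ‖v̂_i − v_i‖ − (‖v̂_i‖‖v_i‖ − 1)‖u‖ ≥ ‖v̂_i − v_i‖ − (1+ε/4−1)(1+ε/4) ≥ ‖v̂_i − v_i‖ − ε/2`,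
> which is the desired bound. […] Finally, we can get access to `v̂_i = R†\bar v_i`, where
> `\bar v_i ∈ ℂ^r` satisfies `\bar v_i†\bar v_i = \bar f_i(CC†)`.

What is formalized (real matrices, the tree's Frobenius-norm SQ toolbox; `w` stands for the
printed `(η/8)‖X‖²`, `est` for `λ̂_i`; eigenpairs are Mathlib's `IsHermitian.eigenvalues` /
`eigenvectorBasis` of `XᵀX`, indexed by `Fin n`, so "the `i`-th largest eigenvalue with gap `η`"
is rendered index-wise as "`λ_{j₀}` is `≥ 8w`-separated from every other `λ_j`", which is what the
printed gap `η` and `|λ̂_i − λ_i| ≤ (η/8)‖X‖²` are used for):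

* **the filter** `bump est w` (`= 1` on `|x − est| ≤ w`, `= 0` on `|x − est| ≥ 2w`, linear in
  between; values in `[0,1]`; `1/w`-Lipschitz; `bump est w 0 = 0` once `2w ≤ est`) and
  `bumpBar est w x = bump est w x / x` (the printed `\bar f_i`; `x·\bar f_i(x) = f_i(x)`), with
  the Lipschitz constant of `\bar f_i` PROVED as `L/a + 1/a²`, `a = est − 2w`, `L = 1/w`
  (`abs_div_sub_div_le`; the paper's `Õ` absorbs this constant — its displayed
  `\bar L = 1/(η‖X‖²(λ̂_i − (η/4)‖X‖²))` is `L/(8a)`, short of the true Lipschitz constant of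
  `f_i(x)/x` by the factor `8` and the `1/a²` term; immaterial there, explicit here);
* **"`f_i(X†X) = v_iv_i†` exactly"**: for a Hermitian matrix and any real `f` vanishing at all
  eigenvalues but the one of index `j₀`, `f(A) = f(λ_{j₀}) · v_{j₀}v_{j₀}*`
  (`cfc_eq_smul_vecMulVec`, over `RCLike 𝕜`, from the diagonal form
  `Literature.LinearAlgebra.Matrix.cfc_apply_eq_sum`); for the filter under the gap hypothesis
  `|λ_j − λ_{j₀}| ≥ 8w (j ≠ j₀)` and `|est − λ_{j₀}| ≤ w`: `bump(XᵀX) = v vᵀ`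
  (`cfc_bump_eq_vecMulVec`);
* **the error chain** (deterministic, for ANY sketch outcome `R = SX`, `C`):
  `‖Rᵀ\bar f(CCᵀ)R − v vᵀ‖_F ≤ (1/w)‖RᵀR − XᵀX‖_F + ‖R‖_F²((1/w)/a + 1/a²)‖RRᵀ − CCᵀ‖_F`
  (`eigenvector_filter_error_le`: the tree's decomposition `evenSVT_error_le` and Lemma 5.4
  `frobNorm_cfc_gram_sub_le`) — so the data-dependent choice `est = λ̂_i(CC†)` of the printed
  proof costs nothing: the bound holds for every admissible `est` simultaneously;
* **"this approximation is an outer product"**: if all eigenvalues of `CCᵀ` but the one of index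
  `k₀` are `≥ 2w` away from `est`, then `\bar f(CCᵀ) = \bar f(μ_{k₀}) u uᵀ` and
  `Rᵀ\bar f(CCᵀ)R = v̂ v̂ᵀ` with the explicit `v̂ = √(\bar f(μ_{k₀})) · Rᵀu`
  (`cfc_bumpBar_eq_smul_vecMulVec`, `transpose_mul_cfc_bumpBar_mul_eq_vecMulVec`);
* **the read-out `v̂v̂ᵀ ≈ vvᵀ ⇒ v̂ ≈ ±v`** (`min_normSq_sub_add_le`): for `‖v‖ = 1`,
  `min(‖v̂ − v‖², ‖v̂ + v‖²) ≤ 2‖v̂v̂ᵀ − vvᵀ‖_F²`, via the exact identity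
  `‖v̂v̂ᵀ − vvᵀ‖_F² = ‖v̂‖⁴ + 1 − 2⟨v̂,v⟩²`.  Deviation, documented: the printed chain's step
  "`≥ ‖v̂_i − v_i‖ − (⟨v̂_i,v_i⟩ − 1)‖v̂_i‖`" followed by
  "`(⟨v̂_i,v_i⟩ − 1) ≤ ‖v̂_i‖‖v_i‖ − 1`" is a valid lower bound only when `⟨v̂_i, v_i⟩ ≥ 1`
  (an eigenvector is determined up to sign, and for `⟨v̂_i,v_i⟩ < 1` the subtracted term has
  the wrong sign); the identity above replaces it and gives
  `‖v̂ ∓ v‖ ≤ √2·‖v̂v̂ᵀ − vvᵀ‖_F ≤ ε/√2` from the printed `‖v̂v̂ᵀ − vvᵀ‖ ≤ ε/2`, i.e. the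
  Corollary's `‖v̂_i − v_i‖ ≤ ε` for the correctly signed `v̂_i`;
* the eigenvalue-estimate arithmetic `Σ_{i<k}|λ̂_i − λ_i| ≤ √k·√(Σ_i (λ̂_i − λ_i)²)` and
  `|λ̂_i − λ_i| ≤ √(Σ_j (λ̂_j − λ_j)²)` for the tree's padded `ℓ²` distance `l2dist` of
  `sqSingularValues` (`abs_sub_le_l2dist`, `sum_abs_sub_le_sqrt_mul_l2dist`);
* **the probability**: the `f`-free good event of the two-stage sketch — key lemma for `S`,
  Lemma 2.14, key lemma for `T†` — has two-stage mass `> 1 − δ₁ − δ₂ − δ₃`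
  (`two_sketch_good_event`, the common randomness of `approximating_singular_values` and
  `even_singular_value_transformation`, exported once as an event), and on it BOTH the
  eigenvalue estimates (via `sqSingularValues_sketch_dist_le`) AND the eigenvector bound for
  every `w, est, j₀, k₀` at once hold (`good_event_consequences`); assembled:
  `pca_eigenvector_error` (pointwise) and **`low_rank_pca`** (Cor. 4.8 in the tree's two-stage-mass
  language).  Since the event is uniform in the component index, the paper's union bound
  ("choosing failure probability `δ/k`") is not needed in this form.

* **the printed gap and the output access**: `separated_of_consecutive_gaps` (the sorted-spectrum
  gap `η` of Problem 4.7 ⇒ the index separation used above), `eigenvalues_equiv_eq` /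
  `sep_eigenvalues_of_sep_eigenvalues₀` (Mathlib's `eigenvalues` = sorted `eigenvalues₀` re-indexed,
  so `v_{e i}` is an eigenvector of the `i`-th largest eigenvalue), and `outputWitness` —
  `SQ_φ(v̂)` for `v̂ = Rᵀv̄` by the linear-combination lemma with the printed
  `φ = s Σ_t v̄_t²‖R(t,·)‖²/‖Rᵀv̄‖²` (`outputWitness_phi_eq`), for exact `SQ` access to the rows of
  `R` (Problem 4.7 is stated for `SQ(X)`).

Not formalized here: the running-time bookkeeping (`r, c = Õ(…)` — read off by making the
explicit bound `≤ ε²/2`) and the paper's `≲` simplifications of `φ`.  Real matrices throughout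
(the tree's SQ toolbox is real); no named facts are introduced; everything stated is proved.

## References
* [ChiaEtAl2022] N.-H. Chia, A. Gilyén, T. Li, H.-H. Lin, E. Tang, C. Wang, J. ACM 69(5) (2022)
  33:1–33:72, doi:10.1145/3549524 (arXiv:1910.06151, held as `paper:arxiv-1910.06151`: §4.3,
  Problem 4.7 and Corollary 4.8 with its proof, pp. 25–26 of the held text).
* [Tang2021PCA] E. Tang, *Quantum principal component analysis only achieves an exponential
  speedup because of its state preparation assumptions*, Phys. Rev. Lett. 127, 060503 (2021)
  (arXiv:1811.00414) — the original dequantized PCA, cited by [ChiaEtAl2022] for Problem 4.7.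
* [LloydMohseniRebentrost2014] S. Lloyd, M. Mohseni, P. Rebentrost, *Quantum principal component
  analysis*, Nature Physics 10, 631–633 (2014) — the quantum algorithm being dequantized.
-/

noncomputable section

open scoped Matrix

namespace Literature.Computability.QuantumComplexity

namespace SampleQuery

namespace LowRankPCA

open Finset

/-! ### The eigenvalue filter `f_i` and `\bar f_i(x) = f_i(x)/x` -/

/-- CGLLTW's eigenvalue filter `f_i`: `1` for `|x − est| ≤ w`, `0` for `|x − est| ≥ 2w`, linear in
between (`est = λ̂_i`, `w = (η/8)‖X‖²`). [cite: ChiaEtAl2022, §4.3 proof of Cor. 4.8 (the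
displayed five-case definition of `f_i`)] -/
def bump (est w x : ℝ) : ℝ := max 0 (min 1 (2 - |x - est| / w))

/-- `\bar f_i(x) = f_i(x)/x` (with `0/0 = 0`). [cite: ChiaEtAl2022, §3.1 Theorem "evenSing"
(`\bar f(x) := (f(x) − f(0))/x`) and §4.3 proof of Cor. 4.8 ("note `f_i(0) = 0`")] -/
def bumpBar (est w x : ℝ) : ℝ := bump est w x / x

/-- `f_i ≥ 0`. [cite: ChiaEtAl2022, §4.3 proof of Cor. 4.8] -/
theorem bump_nonneg (est w x : ℝ) : 0 ≤ bump est w x := le_max_left _ _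

/-- `f_i ≤ 1`. [cite: ChiaEtAl2022, §4.3 proof of Cor. 4.8] -/
theorem bump_le_one (est w x : ℝ) : bump est w x ≤ 1 := max_le zero_le_one (min_le_left _ _)

/-- `|f_i| ≤ 1`. [cite: ChiaEtAl2022, §4.3 proof of Cor. 4.8] -/
theorem abs_bump_le_one (est w x : ℝ) : |bump est w x| ≤ 1 := by
  rw [abs_of_nonneg (bump_nonneg est w x)]; exact bump_le_one est w x

/-- "one when `|x − λ̂_i| ≤ (η/8)‖X‖²`". [cite: ChiaEtAl2022, §4.3 proof of Cor. 4.8] -/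
theorem bump_eq_one {est w x : ℝ} (hw : 0 < w) (h : |x - est| ≤ w) : bump est w x = 1 := by
  have h1 : |x - est| / w ≤ 1 := (div_le_one hw).mpr h
  rw [bump, min_eq_left (by linarith), max_eq_right zero_le_one]

/-- "zero when `|x − λ̂_i| ≥ (η/4)‖X‖²`". [cite: ChiaEtAl2022, §4.3 proof of Cor. 4.8] -/
theorem bump_eq_zero {est w x : ℝ} (hw : 0 < w) (h : 2 * w ≤ |x - est|) : bump est w x = 0 := by
  have h2 : 2 ≤ |x - est| / w := (le_div_iff₀ hw).mpr (by linarith)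
  rw [bump, max_eq_left]
  exact (min_le_right _ _).trans (by linarith)

/-- `f_i(0) = 0` as soon as `λ̂_i ≥ (η/4)‖X‖²` ("note `f_i(0) = 0`"). [cite: ChiaEtAl2022, §4.3
proof of Cor. 4.8] -/
theorem bump_zero {est w : ℝ} (hw : 0 < w) (h : 2 * w ≤ est) : bump est w 0 = 0 :=
  bump_eq_zero hw (by rw [zero_sub, abs_neg, abs_of_nonneg (by linarith)]; exact h)

/-- `f_i` vanishes on `(−∞, λ̂_i − 2w]`. [cite: ChiaEtAl2022, §4.3 proof of Cor. 4.8] -/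
theorem bump_eq_zero_of_le {est w x : ℝ} (hw : 0 < w) (h : x ≤ est - 2 * w) : bump est w x = 0 :=
  bump_eq_zero hw (by rw [abs_sub_comm, abs_of_nonneg (by linarith)]; linarith)

/-- `f_i` is `1/w`-Lipschitz (`L = 8/(η‖X‖²)`). [cite: ChiaEtAl2022, §4.3 proof of Cor. 4.8
("`L` the Lipschitz constant of `f_i`", `ε ≲ η/8·… = L‖X‖²·…`)] -/
theorem abs_bump_sub_bump_le {est w : ℝ} (hw : 0 < w) (x y : ℝ) :
    |bump est w x - bump est w y| ≤ (1 / w) * |x - y| := by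
  unfold bump
  have h1 :=
    abs_max_sub_max_le_max (0 : ℝ) (min 1 (2 - |x - est| / w)) 0 (min 1 (2 - |y - est| / w))
  have h2 := abs_min_sub_min_le_max (1 : ℝ) (2 - |x - est| / w) 1 (2 - |y - est| / w)
  simp only [sub_self, abs_zero] at h1 h2
  replace h1 := h1.trans (max_le (abs_nonneg _) le_rfl)
  replace h2 := h2.trans (max_le (abs_nonneg _) le_rfl)
  have h3 : |2 - |x - est| / w - (2 - |y - est| / w)| ≤ 1 / w * |x - y| := by
    rw [show (2 : ℝ) - |x - est| / w - (2 - |y - est| / w) = (|y - est| - |x - est|) / w by ring,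
      abs_div, abs_of_pos hw, div_le_iff₀ hw,
      show (1 : ℝ) / w * |x - y| * w = |x - y| by field_simp]
    calc |(|y - est| - |x - est|)| ≤ |(y - est) - (x - est)| := abs_abs_sub_abs_le_abs_sub _ _
      _ = |x - y| := by rw [show y - est - (x - est) = y - x by ring, abs_sub_comm]
  exact h1.trans (h2.trans h3)

/-- `x · \bar f_i(x) = f_i(x)` for every real `x` (at `x = 0` because `f_i(0) = 0`). [cite:
ChiaEtAl2022, §4.3 proof of Cor. 4.8 ("note `f_i(0) = 0`")] -/
theorem mul_bumpBar {est w : ℝ} (hw : 0 < w) (h : 2 * w ≤ est) (x : ℝ) :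
    x * bumpBar est w x = bump est w x := by
  unfold bumpBar
  by_cases hx : x = 0
  · rw [hx, bump_zero hw h]; simp
  · exact mul_div_cancel₀ _ hx

/-- `\bar f_i ≥ 0` everywhere (for `λ̂_i > 2w`: `f_i ≥ 0` vanishes on `(−∞, 0]`). [cite:
ChiaEtAl2022, §4.3 proof of Cor. 4.8] -/
theorem bumpBar_nonneg {est w : ℝ} (hw : 0 < w) (h : 2 * w ≤ est) (x : ℝ) :
    0 ≤ bumpBar est w x := by
  unfold bumpBar
  rcases le_or_gt x 0 with hx | hx
  · rw [bump_eq_zero_of_le hw (by linarith)]; simp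
  · exact div_nonneg (bump_nonneg _ _ _) hx.le

/-- **Lipschitz constant of `g(x) = f(x)/x`**: if `f` vanishes on `(−∞, a]` (`a > 0`),
`|f| ≤ 1` and `f` is `L`-Lipschitz, then `|f(x)/x − f(y)/y| ≤ (L/a + 1/a²)|x − y|` for all real
`x, y` (with `0/0 = 0`).  (The step the paper leaves to `Õ`: its displayed `\bar L` for `\bar f_i`
is `L/(8a)`.) [cite: ChiaEtAl2022, §4.3 proof of Cor. 4.8 (the display computing `c` from
`\bar L`)] -/
theorem abs_div_sub_div_le {f : ℝ → ℝ} {L a : ℝ} (ha : 0 < a) (hL : 0 ≤ L)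
    (hf0 : ∀ x, x ≤ a → f x = 0) (hf1 : ∀ x, |f x| ≤ 1)
    (hfL : ∀ x y, |f x - f y| ≤ L * |x - y|) (x y : ℝ) :
    |f x / x - f y / y| ≤ (L / a + 1 / a ^ 2) * |x - y| := by
  have hK : 0 ≤ L / a + 1 / a ^ 2 := by positivity
  -- one-sided case: `x ≤ a < y`
  have side : ∀ {x y : ℝ}, x ≤ a → a < y → |f x / x - f y / y| ≤ (L / a + 1 / a ^ 2) * |x - y| := by
    intro x y hxa hay
    have hy0 : 0 < y := ha.trans hay
    rw [hf0 x hxa, zero_div, zero_sub, abs_neg, abs_div, abs_of_pos hy0]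
    have h1 : |f y| ≤ L * |x - y| := by
      have := hfL y a
      rw [hf0 a le_rfl, sub_zero] at this
      refine this.trans (mul_le_mul_of_nonneg_left ?_ hL)
      rw [abs_of_pos (by linarith), abs_sub_comm, abs_of_pos (by linarith)]; linarith
    calc |f y| / y ≤ L * |x - y| / a := by
          rw [div_le_div_iff₀ hy0 ha]
          calc |f y| * a ≤ L * |x - y| * a := mul_le_mul_of_nonneg_right h1 ha.le
            _ ≤ L * |x - y| * y := mul_le_mul_of_nonneg_left hay.le (by positivity)
      _ = (L / a) * |x - y| := by ring
      _ ≤ (L / a + 1 / a ^ 2) * |x - y| :=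
          mul_le_mul_of_nonneg_right (le_add_of_nonneg_right (by positivity)) (abs_nonneg _)
  rcases le_or_gt x a with hxa | hax
  · rcases le_or_gt y a with hya | hay
    · rw [hf0 x hxa, hf0 y hya]; simpa using mul_nonneg hK (abs_nonneg (x - y))
    · exact side hxa hay
  · rcases le_or_gt y a with hya | hay
    · rw [abs_sub_comm, abs_sub_comm x y]; exact side hya hax
    · have hx0 : 0 < x := ha.trans hax
      have hy0 : 0 < y := ha.trans hay
      have hxy : f x / x - f y / y = ((f x - f y) * y + f y * (y - x)) / (x * y) := by
        field_simp; ring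
      rw [hxy, abs_div, abs_of_pos (mul_pos hx0 hy0), div_le_iff₀ (mul_pos hx0 hy0)]
      calc |(f x - f y) * y + f y * (y - x)|
          ≤ |(f x - f y) * y| + |f y * (y - x)| := abs_add_le _ _
        _ = |f x - f y| * y + |f y| * |x - y| := by
            rw [abs_mul, abs_mul, abs_of_pos hy0, abs_sub_comm y x]
        _ ≤ L * |x - y| * y + 1 * |x - y| :=
            add_le_add (mul_le_mul_of_nonneg_right (hfL x y) hy0.le)
              (mul_le_mul_of_nonneg_right (hf1 y) (abs_nonneg _))
        _ ≤ L * |x - y| * y * (x / a) + 1 * |x - y| * (x * y / a ^ 2) := by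
            have hxa' : 1 ≤ x / a := (one_le_div ha).mpr hax.le
            have hxya : 1 ≤ x * y / a ^ 2 := by
              rw [one_le_div (by positivity), sq]
              exact mul_le_mul hax.le hay.le ha.le hx0.le
            exact add_le_add (le_mul_of_one_le_right (by positivity) hxa')
              (le_mul_of_one_le_right (by positivity) hxya)
        _ = (L / a + 1 / a ^ 2) * |x - y| * (x * y) := by
            field_simp

/-- The Lipschitz constant of `\bar f_i`:
`|\bar f_i(x) − \bar f_i(y)| ≤ ((1/w)/a + 1/a²)|x − y|` with `a = λ̂_i − 2w > 0`.
[cite: ChiaEtAl2022, §4.3 proof of Cor. 4.8 (`\bar L`)] -/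
theorem abs_bumpBar_sub_bumpBar_le {est w : ℝ} (hw : 0 < w) (h : 2 * w < est) (x y : ℝ) :
    |bumpBar est w x - bumpBar est w y| ≤
      ((1 / w) / (est - 2 * w) + 1 / (est - 2 * w) ^ 2) * |x - y| :=
  abs_div_sub_div_le (f := bump est w) (by linarith) (by positivity)
    (fun z hz => bump_eq_zero_of_le hw hz) (abs_bump_le_one est w)
    (abs_bump_sub_bump_le hw) x y

/-! ### "`f_i(X†X) = v_iv_i†` exactly": functions vanishing at all eigenvalues but one -/

section spectral

variable {𝕜 : Type*} [RCLike 𝕜] {ι : Type*} [Fintype ι] [DecidableEq ι]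

/-- **A function of a Hermitian matrix supported on one eigen-index is a multiple of the
eigenprojector**: if `f(λ_j) = 0` for every `j ≠ j₀`, then `f(A) = f(λ_{j₀}) · v_{j₀} v_{j₀}*`
with `v_{j₀}` the `j₀`-th vector of Mathlib's orthonormal eigenbasis (whatever the multiplicities:
if `λ_j = λ_{j₀}` for some `j ≠ j₀` the hypothesis forces `f(λ_{j₀}) = 0` and both sides vanish).
[cite: ChiaEtAl2022, §4.3 proof of Cor. 4.8 ("we can conclude that `f_i(X†X) = v_iv_i†`
exactly")] -/
theorem cfc_eq_smul_vecMulVec {A : Matrix ι ι 𝕜} (hA : A.IsHermitian) (f : ℝ → ℝ) (j₀ : ι)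
    (hf : ∀ j, j ≠ j₀ → f (hA.eigenvalues j) = 0) :
    cfc f A = ((f (hA.eigenvalues j₀) : ℝ) : 𝕜) •
      Matrix.vecMulVec (⇑(hA.eigenvectorBasis j₀)) (star ⇑(hA.eigenvectorBasis j₀)) := by
  ext x y
  rw [Literature.LinearAlgebra.Matrix.cfc_apply_eq_sum hA.eigenvectorUnitary.2 hA.spectral_theorem
    f x y, Finset.sum_eq_single j₀ (fun j _ hj => by rw [hf j hj]; simp) (by simp)]
  simp only [Matrix.smul_apply, Matrix.vecMulVec_apply, Pi.star_apply,
    Matrix.IsHermitian.eigenvectorUnitary_apply, smul_eq_mul]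
  ring

end spectral

variable {m n s c : ℕ}

/-- Real form: for a real symmetric `A` and `f` vanishing at all eigenvalues but `λ_{j₀}`,
`f(A) = f(λ_{j₀}) · v vᵀ`. [cite: ChiaEtAl2022, §4.3 proof of Cor. 4.8] -/
theorem cfc_eq_smul_vecMulVec_real {A : Matrix (Fin n) (Fin n) ℝ} (hA : A.IsHermitian)
    (f : ℝ → ℝ) (j₀ : Fin n) (hf : ∀ j, j ≠ j₀ → f (hA.eigenvalues j) = 0) :
    cfc f A = f (hA.eigenvalues j₀) •
      Matrix.vecMulVec (⇑(hA.eigenvectorBasis j₀)) (⇑(hA.eigenvectorBasis j₀)) := by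
  have h := cfc_eq_smul_vecMulVec (𝕜 := ℝ) hA f j₀ hf
  simpa only [RCLike.ofReal_real_eq_id, id_eq, star_trivial] using h

/-- **"From the eigenvalue gap and the bound `|λ̂_i − λ_i| ≤ (η/8)‖X‖²` we can conclude that
`f_i(X†X) = v_iv_i†` exactly."**  With `w = (η/8)‖X‖²`: if `|est − λ_{j₀}| ≤ w` and every other
eigenvalue is `≥ 8w` away from `λ_{j₀}`, the filter of `A` is the eigenprojector `v vᵀ`.
[cite: ChiaEtAl2022, §4.3 proof of Cor. 4.8] -/
theorem cfc_bump_eq_vecMulVec {A : Matrix (Fin n) (Fin n) ℝ} (hA : A.IsHermitian) (j₀ : Fin n)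
    {est w : ℝ} (hw : 0 < w) (hest : |est - hA.eigenvalues j₀| ≤ w)
    (hsep : ∀ j, j ≠ j₀ → 8 * w ≤ |hA.eigenvalues j - hA.eigenvalues j₀|) :
    cfc (bump est w) A =
      Matrix.vecMulVec (⇑(hA.eigenvectorBasis j₀)) (⇑(hA.eigenvectorBasis j₀)) := by
  rw [cfc_eq_smul_vecMulVec_real hA (bump est w) j₀, bump_eq_one hw (by rwa [abs_sub_comm]),
    one_smul]
  intro j hj
  refine bump_eq_zero hw ?_
  have h := abs_sub_abs_le_abs_sub (hA.eigenvalues j - hA.eigenvalues j₀) (est - hA.eigenvalues j₀)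
  rw [show hA.eigenvalues j - hA.eigenvalues j₀ - (est - hA.eigenvalues j₀) =
    hA.eigenvalues j - est by ring] at h
  linarith [hsep j hj]

/-! ### The read-out: `v̂v̂ᵀ ≈ vvᵀ` forces `v̂ ≈ ±v` -/

/-- The exact identity `‖uuᵀ − vvᵀ‖_F² = ‖u‖⁴ − 2⟨u,v⟩² + ‖v‖⁴`. [folklore] -/
private theorem frobSq_vecMulVec_sub_vecMulVec (u v : Fin n → ℝ) :
    frobSq (Matrix.vecMulVec u u - Matrix.vecMulVec v v) =
      normSq u ^ 2 - 2 * (∑ i, u i * v i) ^ 2 + normSq v ^ 2 := by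
  simp only [frobSq_eq_sum_sq, Matrix.sub_apply, Matrix.vecMulVec_apply, normSq]
  have h : ∀ i j : Fin n, (u i * u j - v i * v j) ^ 2 =
      u i ^ 2 * u j ^ 2 + v i ^ 2 * v j ^ 2 - 2 * ((u i * v i) * (u j * v j)) := fun i j => by ring
  have e1 : ∑ i, ∑ j, u i ^ 2 * u j ^ 2 = (∑ i, u i ^ 2) * ∑ j, u j ^ 2 := by
    rw [Finset.sum_mul_sum]
  have e2 : ∑ i, ∑ j, v i ^ 2 * v j ^ 2 = (∑ i, v i ^ 2) * ∑ j, v j ^ 2 := by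
    rw [Finset.sum_mul_sum]
  have e3 : ∑ i, ∑ j, 2 * ((u i * v i) * (u j * v j)) =
      2 * ((∑ i, u i * v i) * ∑ j, u j * v j) := by
    rw [Finset.sum_mul_sum, Finset.mul_sum]
    refine Finset.sum_congr rfl fun i _ => ?_
    rw [Finset.mul_sum]
  simp_rw [h, Finset.sum_sub_distrib, Finset.sum_add_distrib]
  rw [e1, e2, e3]; ring

/-- `‖u − v‖² = ‖u‖² − 2⟨u,v⟩ + ‖v‖²`. [folklore] -/
private theorem normSq_sub_eq (u v : Fin n → ℝ) :
    normSq (u - v) = normSq u - 2 * (∑ i, u i * v i) + normSq v := by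
  simp only [normSq, Pi.sub_apply, sub_sq, Finset.sum_add_distrib, Finset.sum_sub_distrib]
  simp_rw [show ∀ i : Fin n, 2 * u i * v i = 2 * (u i * v i) from fun i => by ring,
    ← Finset.mul_sum]

/-- `‖u + v‖² = ‖u‖² + 2⟨u,v⟩ + ‖v‖²`. [folklore] -/
private theorem normSq_add_eq (u v : Fin n → ℝ) :
    normSq (u + v) = normSq u + 2 * (∑ i, u i * v i) + normSq v := by
  have h := normSq_sub_eq u (-v)
  simp only [sub_neg_eq_add, Pi.neg_apply, mul_neg, Finset.sum_neg_distrib, mul_neg,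
    sub_neg_eq_add] at h
  rw [h]; congr 1; simp [normSq]

/-- **Read-out.** For a unit vector `v` and any `u`:
`min(‖u − v‖², ‖u + v‖²) ≤ 2‖uuᵀ − vvᵀ‖_F²` — so `‖Rᵀ\bar f_i(CC†)R − v_iv_i†‖_F ≤ ε/2` with
`Rᵀ\bar f_i(CC†)R = v̂_iv̂_i†` gives `‖v̂_i ∓ v_i‖ ≤ ε/√2 ≤ ε` for the correctly signed `v̂_i`.
(Replaces the printed triangle-inequality chain, whose third step needs `⟨v̂_i, v_i⟩ ≥ 1`; see the
module docstring.) [cite: ChiaEtAl2022, §4.3 proof of Cor. 4.8 (the display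
"`ε/2 ≥ ‖(v̂_iv̂_i† − v_iv_i†)v_i‖ … ≥ ‖v̂_i − v_i‖ − ε/2`")] -/
theorem min_normSq_sub_add_le (u v : Fin n → ℝ) (hv : normSq v = 1) :
    min (normSq (u - v)) (normSq (u + v)) ≤
      2 * frobSq (Matrix.vecMulVec u u - Matrix.vecMulVec v v) := by
  have hF0 : 0 ≤ frobSq (Matrix.vecMulVec u u - Matrix.vecMulVec v v) := frobSq_nonneg _
  rw [frobSq_vecMulVec_sub_vecMulVec, hv] at hF0 ⊢
  rw [normSq_sub_eq, normSq_add_eq, hv]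
  set a := normSq u with ha
  set t := ∑ i, u i * v i with ht
  have ha0 : 0 ≤ a := normSq_nonneg u
  -- the key algebra: `(a + 1 − 2|t|)(a + 1 + 2|t|) = (a+1)² − 4t² ≤ 2(a² − 2t² + 1)`
  have hkey : ∀ τ : ℝ, 0 ≤ τ → τ ^ 2 = t ^ 2 → a - 2 * τ + 1 ≤ 2 * (a ^ 2 - 2 * t ^ 2 + 1 ^ 2) := by
    intro τ hτ hτt
    by_cases hL : a - 2 * τ + 1 ≤ 0
    · linarith
    · replace hL := lt_of_not_ge hL
      have hM : 1 ≤ a + 2 * τ + 1 := by linarith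
      calc a - 2 * τ + 1 ≤ (a - 2 * τ + 1) * (a + 2 * τ + 1) := le_mul_of_one_le_right hL.le hM
        _ ≤ 2 * (a ^ 2 - 2 * t ^ 2 + 1 ^ 2) := by nlinarith [sq_nonneg (a - 1)]
  rcases le_or_gt 0 t with ht0 | ht0
  · exact (min_le_left _ _).trans (hkey t ht0 rfl)
  · have h := hkey (-t) (by linarith) (by ring)
    exact (min_le_right _ _).trans (by linarith)

/-- The eigenbasis vectors are unit vectors: `Σ_i v_i² = 1`. [folklore] -/
private theorem normSq_eigenvectorBasis {A : Matrix (Fin n) (Fin n) ℝ} (hA : A.IsHermitian)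
    (j : Fin n) :
    normSq (⇑(hA.eigenvectorBasis j)) = 1 := by
  have h := hA.eigenvectorBasis.orthonormal.1 j
  rw [EuclideanSpace.norm_eq, Real.sqrt_eq_one] at h
  simpa only [normSq, Real.norm_eq_abs, sq_abs] using h

/-! ### The error chain for one eigenvector (deterministic in the sketch outcome) -/

/-- **The error chain of Corollary 4.8 for one eigenvector, pointwise in the sketch outcome.**
For ANY `R` (`s×n`, in the application `R = SX`) and `C` (`s×c`, in the application `C = RT`),
any index `j₀` whose eigenvalue `λ_{j₀}` of `XᵀX` is `≥ 8w`-separated from the others, and any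
estimate `est` with `|est − λ_{j₀}| ≤ w` and `est > 2w`:
`‖Rᵀ\bar f(CCᵀ)R − v_{j₀}v_{j₀}ᵀ‖_F ≤ (1/w)·‖RᵀR − XᵀX‖_F + ‖R‖_F²·((1/w)/a + 1/a²)·‖RRᵀ − CCᵀ‖_F`
(`a = est − 2w`; `f = bump est w`, `\bar f = bumpBar est w`): "`f_i(X†X) = v_iv_i†` exactly"
(`cfc_bump_eq_vecMulVec`), the even-SVT decomposition (`evenSVT_error_le`) and Lemma 5.4 in
Frobenius form (`frobNorm_cfc_gram_sub_le`) for `f` (`L = 1/w`) and for `\bar f`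
(`\bar L = (1/w)/a + 1/a²`).  The paper's `est = λ̂_i` is computed from the same `C`; since the
bound holds for every admissible `est` at once, that data-dependence costs nothing.
[cite: ChiaEtAl2022, §4.3 proof of Cor. 4.8 ("by (thm:evenSing), we can conclude that
`R†\bar f_i(CC†)R` approximates `v_iv_i†`, with `C, R` the exact approximations used to estimate
singular values")] -/
theorem eigenvector_filter_error_le (X : Matrix (Fin m) (Fin n) ℝ) (hX : (Xᵀ * X).IsHermitian)
    (R : Matrix (Fin s) (Fin n) ℝ) (C : Matrix (Fin s) (Fin c) ℝ) (j₀ : Fin n) {est w : ℝ}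
    (hw : 0 < w) (hwe : 2 * w < est) (hest : |est - hX.eigenvalues j₀| ≤ w)
    (hsep : ∀ j, j ≠ j₀ → 8 * w ≤ |hX.eigenvalues j - hX.eigenvalues j₀|) :
    Real.sqrt (frobSq (Rᵀ * cfc (bumpBar est w) (C * Cᵀ) * R -
        Matrix.vecMulVec (⇑(hX.eigenvectorBasis j₀)) (⇑(hX.eigenvectorBasis j₀)))) ≤
      (1 / w) * Real.sqrt (frobSq (Rᵀ * R - Xᵀ * X)) +
        frobSq R * (((1 / w) / (est - 2 * w) + 1 / (est - 2 * w) ^ 2) *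
          Real.sqrt (frobSq (R * Rᵀ - C * Cᵀ))) := by
  rw [← cfc_bump_eq_vecMulVec hX j₀ hw hest hsep]
  have ha : 0 < est - 2 * w := by linarith
  have hdec := evenSVT_error_le R C X (bump est w) (bumpBar est w)
    (fun x _ => mul_bumpBar hw hwe.le x)
  refine hdec.trans (add_le_add ?_ (mul_le_mul_of_nonneg_left ?_ (frobSq_nonneg R)))
  · exact frobNorm_cfc_gram_sub_le R X (bump est w) (by positivity)
      (fun x y _ _ => abs_bump_sub_bump_le hw x y)
  · have h := frobNorm_cfc_gram_sub_le Rᵀ Cᵀ (bumpBar est w)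
      (L := (1 / w) / (est - 2 * w) + 1 / (est - 2 * w) ^ 2)
      (add_nonneg (div_nonneg (by positivity) ha.le) (by positivity))
      (fun x y _ _ => abs_bumpBar_sub_bumpBar_le hw hwe x y)
    simpa only [Matrix.transpose_transpose] using h

/-! ### "This approximation is an outer product": the explicit `v̂` -/

/-- If all eigenvalues of a symmetric `M` (in the application `M = CCᵀ`) but the one of index `k₀`
are `≥ 2w` away from `est`, then `\bar f(M) = \bar f(μ_{k₀}) · u uᵀ` with `u` the `k₀`-th
eigenbasis vector. [cite: ChiaEtAl2022, §4.3 proof of Cor. 4.8 ("`f_i` is chosen with respect to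
`λ̂_i` such that `R†\bar f_i(CC†)R` is rank one, since `CC†` has one eigenvalue between
`λ̂_i − (η/4)‖X‖²` and `λ̂_i + (η/4)‖X‖²`")] -/
theorem cfc_bumpBar_eq_smul_vecMulVec {M : Matrix (Fin s) (Fin s) ℝ} (hM : M.IsHermitian)
    (k₀ : Fin s) {est w : ℝ} (hw : 0 < w)
    (hsepC : ∀ k, k ≠ k₀ → 2 * w ≤ |hM.eigenvalues k - est|) :
    cfc (bumpBar est w) M = bumpBar est w (hM.eigenvalues k₀) •
      Matrix.vecMulVec (⇑(hM.eigenvectorBasis k₀)) (⇑(hM.eigenvectorBasis k₀)) :=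
  cfc_eq_smul_vecMulVec_real hM _ k₀ fun k hk => by
    unfold bumpBar; rw [bump_eq_zero hw (hsepC k hk), zero_div]

/-- **The outer product, explicitly**: under the same separation, `Rᵀ\bar f(M)R = v̂ v̂ᵀ` with
`v̂ = √(\bar f(μ_{k₀})) · Rᵀu` (the paper's `v̂_i = R†\bar v_i`,
`\bar v_i\bar v_i† = \bar f_i(CC†)`, `\bar v_i = √(\bar f_i(μ_{k₀})) u`). [cite: ChiaEtAl2022, §4.3
proof of Cor. 4.8 ("Thus, this approximation is an outer product, `R†\bar f_i(CC†)R = v̂_iv̂_i†`"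
and "we can get access to `v̂_i = R†\bar v_i`, where `\bar v_i ∈ ℂ^r` satisfies
`\bar v_i†\bar v_i = \bar f_i(CC†)`")] -/
theorem transpose_mul_cfc_bumpBar_mul_eq_vecMulVec (R : Matrix (Fin s) (Fin n) ℝ)
    {M : Matrix (Fin s) (Fin s) ℝ} (hM : M.IsHermitian) (k₀ : Fin s) {est w : ℝ} (hw : 0 < w)
    (hwe : 2 * w ≤ est) (hsepC : ∀ k, k ≠ k₀ → 2 * w ≤ |hM.eigenvalues k - est|) :
    Rᵀ * cfc (bumpBar est w) M * R =
      Matrix.vecMulVec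
        (Real.sqrt (bumpBar est w (hM.eigenvalues k₀)) • (Rᵀ *ᵥ ⇑(hM.eigenvectorBasis k₀)))
        (Real.sqrt (bumpBar est w (hM.eigenvalues k₀)) • (Rᵀ *ᵥ ⇑(hM.eigenvectorBasis k₀))) := by
  have hb : 0 ≤ bumpBar est w (hM.eigenvalues k₀) := bumpBar_nonneg hw hwe _
  rw [cfc_bumpBar_eq_smul_vecMulVec hM k₀ hw hsepC, Matrix.mul_smul, Matrix.smul_mul,
    Matrix.mul_vecMulVec, Matrix.vecMulVec_mul, ← Matrix.mulVec_transpose, Matrix.smul_vecMulVec,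
    Matrix.vecMulVec_smul, smul_smul, Real.mul_self_sqrt hb]

/-! ### Eigenvalue estimates from the padded `ℓ²` bound of `approximating_singular_values` -/

/-- "This bound also implies that, for all `i`, `|λ̂_i − λ_i| ≤ …`": one term of the `ℓ²` sum.
[cite: ChiaEtAl2022, §4.3 proof of Cor. 4.8] -/
theorem abs_sub_le_l2dist {N k : ℕ} (hk : k < N) (f g : ℕ → ℝ) : |f k - g k| ≤ l2dist N f g := by
  unfold l2dist
  rw [← Real.sqrt_sq_eq_abs]
  exact Real.sqrt_le_sqrt (Finset.single_le_sum (f := fun i => (f i - g i) ^ 2)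
    (fun i _ => sq_nonneg _) (Finset.mem_range.mpr hk))

/-- "`Σ_{i=1}^k |λ̂_i − λ_i| ≤ √k √(Σ_{i=1}^k (λ̂_i − λ_i)²)`" (Cauchy–Schwarz), continued to
the full padded sum: `Σ_{i<k} |f i − g i| ≤ √k · l2dist N f g` for `k ≤ N`.
[cite: ChiaEtAl2022, §4.3 proof of Cor. 4.8 (the display "These `λ̂_i`'s for `i ∈ [k]` have the
desired property")] -/
theorem sum_abs_sub_le_sqrt_mul_l2dist {N k : ℕ} (hk : k ≤ N) (f g : ℕ → ℝ) :
    ∑ i ∈ range k, |f i - g i| ≤ Real.sqrt k * l2dist N f g := by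
  have hcs := Finset.sum_mul_sq_le_sq_mul_sq (range k) (fun _ => (1 : ℝ)) (fun i => |f i - g i|)
  simp only [one_mul, one_pow, sum_const, card_range, nsmul_eq_mul, mul_one, sq_abs] at hcs
  have hmono : ∑ i ∈ range k, (f i - g i) ^ 2 ≤ ∑ i ∈ range N, (f i - g i) ^ 2 :=
    sum_le_sum_of_subset_of_nonneg (range_subset_range.mpr hk) fun i _ _ => sq_nonneg _
  have hS : 0 ≤ ∑ i ∈ range N, (f i - g i) ^ 2 := sum_nonneg fun i _ => sq_nonneg _
  unfold l2dist
  rw [← Real.sqrt_mul (Nat.cast_nonneg k)]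
  refine (Real.le_sqrt (sum_nonneg fun i _ => abs_nonneg _)
    (mul_nonneg (Nat.cast_nonneg k) hS)).mpr ?_
  exact hcs.trans (mul_le_mul_of_nonneg_left hmono (Nat.cast_nonneg k))

/-! ### Assembly: Corollary 4.8 for one eigenvector, pointwise in the sketch outcome -/

/-- **Corollary 4.8 (one eigenvector), deterministic core.**  Let `X` be real `m×n`, `λ, v` the
eigenpairs of `XᵀX` (Mathlib's eigenbasis), `j₀` an index with `|λ_j − λ_{j₀}| ≥ 8w` for all
`j ≠ j₀` (`w = (η/8)‖X‖²` in the paper) and let `R` (`= SX`), `C` (`= RT`) be any sketch outcome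
with errors `e₁ = ‖RᵀR − XᵀX‖_F`, `e₂ = ‖RRᵀ − M‖_F`, `M = CCᵀ` (any syntactic form `M` of `CCᵀ`,
with eigenpairs `μ, u`).  Let `est` (`= λ̂_i`, in the paper the `i`-th eigenvalue of `CCᵀ`)
satisfy `|est − λ_{j₀}| ≤ w`, `est > 2w`, and suppose the eigenvalues of `M` other than `μ_{k₀}`
are `≥ 2w` away from `est`.  Then the explicit vector `v̂ = √(\bar f(μ_{k₀})) · Rᵀu_{k₀}` satisfies
`min(‖v̂ − v_{j₀}‖², ‖v̂ + v_{j₀}‖²) ≤ 2·((1/w)e₁ + ‖R‖_F²((1/w)/a + 1/a²)e₂)²`, `a = est − 2w` —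
i.e. `‖v̂ ∓ v_{j₀}‖ ≤ ε/√2` whenever the even-SVT error is `≤ ε/2`, as the Corollary asserts (up
to the sign of the eigenvector).  The masses making `e₁, e₂` small: `two_sketch_good_event`.
[cite: ChiaEtAl2022, §4.3 Cor. 4.8 and its proof] -/
theorem pca_eigenvector_error (X : Matrix (Fin m) (Fin n) ℝ) (hX : (Xᵀ * X).IsHermitian)
    (R : Matrix (Fin s) (Fin n) ℝ) (C : Matrix (Fin s) (Fin c) ℝ) {M : Matrix (Fin s) (Fin s) ℝ}
    (hM : M.IsHermitian) (hMC : C * Cᵀ = M) (j₀ : Fin n) (k₀ : Fin s) {est w : ℝ} (hw : 0 < w)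
    (hwe : 2 * w < est) (hest : |est - hX.eigenvalues j₀| ≤ w)
    (hsep : ∀ j, j ≠ j₀ → 8 * w ≤ |hX.eigenvalues j - hX.eigenvalues j₀|)
    (hsepC : ∀ k, k ≠ k₀ → 2 * w ≤ |hM.eigenvalues k - est|) :
    min (normSq (Real.sqrt (bumpBar est w (hM.eigenvalues k₀)) •
            (Rᵀ *ᵥ ⇑(hM.eigenvectorBasis k₀)) - ⇑(hX.eigenvectorBasis j₀)))
        (normSq (Real.sqrt (bumpBar est w (hM.eigenvalues k₀)) •
            (Rᵀ *ᵥ ⇑(hM.eigenvectorBasis k₀)) + ⇑(hX.eigenvectorBasis j₀))) ≤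
      2 * ((1 / w) * Real.sqrt (frobSq (Rᵀ * R - Xᵀ * X)) +
        frobSq R * (((1 / w) / (est - 2 * w) + 1 / (est - 2 * w) ^ 2) *
          Real.sqrt (frobSq (R * Rᵀ - M)))) ^ 2 := by
  have herr := eigenvector_filter_error_le X hX R C j₀ hw hwe hest hsep
  rw [hMC, transpose_mul_cfc_bumpBar_mul_eq_vecMulVec R hM k₀ hw hwe.le hsepC] at herr
  refine (min_normSq_sub_add_le _ _ (normSq_eigenvectorBasis hX j₀)).trans ?_
  refine mul_le_mul_of_nonneg_left ?_ (by norm_num)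
  calc frobSq _ = Real.sqrt (frobSq _) ^ 2 := (Real.sq_sqrt (frobSq_nonneg _)).symm
    _ ≤ _ := pow_le_pow_left₀ (Real.sqrt_nonneg _) herr 2

/-! ### The `f`-free good event of the two-stage sketch and its mass -/

variable {φ : ℝ} {X : Matrix (Fin m) (Fin n) ℝ}

/-- `‖−Y‖_F² = ‖Y‖_F²`. [folklore] (private plumbing) -/
private theorem frobSq_neg'' {k l : ℕ} (Y : Matrix (Fin k) (Fin l) ℝ) : frobSq (-Y) = frobSq Y := by
  simp [frobSq_eq_sum_sq]

/-- Inclusion–exclusion step: the mass of `E ∩ G` is at least the mass of `E` minus the mass of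
`Gᶜ` (non-negative weights). [folklore] (private plumbing) -/
private theorem sum_filter_and_ge'' {ι : Type*} (u : Finset ι) (wt : ι → ℝ) (hw : ∀ i, 0 ≤ wt i)
    (E G : ι → Prop) [DecidablePred E] [DecidablePred G] :
    ∑ i ∈ u.filter E, wt i - ∑ i ∈ u.filter (fun i => ¬ G i), wt i ≤
      ∑ i ∈ u.filter (fun i => E i ∧ G i), wt i := by
  classical
  have hsplit : ∑ i ∈ u.filter E, wt i =
      ∑ i ∈ (u.filter E).filter G, wt i + ∑ i ∈ (u.filter E).filter (fun i => ¬ G i), wt i :=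
    (sum_filter_add_sum_filter_not _ _ _).symm
  rw [hsplit, filter_filter]
  have hle : ∑ i ∈ (u.filter E).filter (fun i => ¬ G i), wt i ≤
      ∑ i ∈ u.filter (fun i => ¬ G i), wt i :=
    sum_le_sum_of_subset_of_nonneg (fun i hi => by
      simp only [mem_filter] at hi ⊢; exact ⟨hi.1.1, hi.2⟩) (fun i _ _ => hw i)
  linarith

/-- Two-stage masses are monotone in the event (non-negative weights). [folklore] -/
private theorem twoStage_mass_mono {p : Fin m → ℝ} {q : (Fin s → Fin m) → Fin n → ℝ}
    (hp : ∀ k, 0 ≤ p k) (hq : ∀ ω k, 0 ≤ q ω k)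
    {G P : (Fin s → Fin m) → (Fin c → Fin n) → Prop} [∀ ω, DecidablePred (G ω)]
    [∀ ω, DecidablePred (P ω)] (hGP : ∀ ω τ, G ω τ → P ω τ) :
    ∑ ω : Fin s → Fin m, iidWeight p ω * ∑ τ ∈ univ.filter (G ω), iidWeight (q ω) τ ≤
      ∑ ω : Fin s → Fin m, iidWeight p ω * ∑ τ ∈ univ.filter (P ω), iidWeight (q ω) τ :=
  sum_le_sum fun ω _ => mul_le_mul_of_nonneg_left
    (sum_le_sum_of_subset_of_nonneg (fun τ hτ => by
        simp only [mem_filter, mem_univ, true_and] at hτ ⊢; exact hGP ω τ hτ)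
      fun τ _ _ => iidWeight_nonneg (hq ω) τ)
    (iidWeight_nonneg hp ω)

/-- **The `f`-free good event of the two-stage sketch** (the common randomness of
(prop:appr-svs) and (thm:evenSing), "with `C, R` the exact approximations used to estimate
singular values").  With `SQ_φ(X)` (`X ≠ 0`), `s, c ≥ 1`, `δ₁, δ₂, δ₃ > 0`, `s ≥ 2φ² ln(1/δ₃)`:
sampling `ω ∈ [m]^s` i.i.d. from `𝒟_X̃` (`R = S_ωX`) and then `τ ∈ [n]^c` i.i.d. from the row-norm
distribution of `(S_ωX̃)ᵀ` (`C = RT_τᵀ`, `CCᵀ = (T_τRᵀ)ᵀ(T_τRᵀ)`), the two-stage mass of the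
outcomes with
`‖RᵀR − XᵀX‖_F < √(8φ² log(2/δ₁)/s)·‖X‖_F²`, `‖RRᵀ − CCᵀ‖_F < φ√(32φ² log(2/δ₂)/c)·‖X‖_F²` and
`‖R‖_F² ≤ φ‖X‖_F²` exceeds `1 − δ₁ − δ₂ − δ₃` — the key lemma for `S`; Lemma 2.14 (`φ_ω ≤ 2φ`
off an event of mass `≤ δ₃`) with the key lemma for `T†` as a `2φ`-oversampled sketch of `(SX)ᵀ`;
`‖SX‖_F² ≤ φ‖X‖_F²`.  Nothing here depends on the function applied afterwards, so every
deterministic consequence (singular values, even SVT for all `f` at once, the data-dependent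
filters `f_i` of Cor. 4.8) holds on this one event. [cite: ChiaEtAl2022, §5.2 proof of Lemma
"Approximating singular values" and §5.3 proof of Theorem "evenSing" (the sketches and their
error events); §4.3 proof of Cor. 4.8 ("with `C, R` the exact approximations used to estimate
singular values")] -/
theorem two_sketch_good_event (W : MatrixOversamplingWitness φ X) (hX : X ≠ 0)
    (hs : 0 < s) (hc : 0 < c) {δ₁ δ₂ δ₃ : ℝ} (hδ₁ : 0 < δ₁) (hδ₂ : 0 < δ₂) (hδ₃ : 0 < δ₃)
    (hsδ : 2 * φ ^ 2 * Real.log (1 / δ₃) ≤ s) :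
    1 - δ₁ - δ₂ - δ₃ <
      ∑ ω : Fin s → Fin m, iidWeight (rowDist W.tilde) ω *
        ∑ τ ∈ univ.filter (fun τ : Fin c → Fin n =>
          Real.sqrt (frobSq ((sketch (rowDist W.tilde) ω * X)ᵀ * (sketch (rowDist W.tilde) ω * X) -
              Xᵀ * X)) < Real.sqrt (8 * φ ^ 2 * Real.log (2 / δ₁) / s) * frobSq X ∧
          Real.sqrt (frobSq ((sketch (rowDist W.tilde) ω * X) * (sketch (rowDist W.tilde) ω * X)ᵀ -
              (sketch (rowDist (sketch (rowDist W.tilde) ω * W.tilde)ᵀ) τ *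
                  (sketch (rowDist W.tilde) ω * X)ᵀ)ᵀ *
                (sketch (rowDist (sketch (rowDist W.tilde) ω * W.tilde)ᵀ) τ *
                  (sketch (rowDist W.tilde) ω * X)ᵀ))) <
            φ * Real.sqrt (32 * φ ^ 2 * Real.log (2 / δ₂) / c) * frobSq X ∧
          frobSq (sketch (rowDist W.tilde) ω * X) ≤ φ * frobSq X),
          iidWeight (rowDist (sketch (rowDist W.tilde) ω * W.tilde)ᵀ) τ := by
  classical
  -- notation
  set p : Fin m → ℝ := rowDist W.tilde with hpdef
  set θ₁ : ℝ := Real.sqrt (8 * φ ^ 2 * Real.log (2 / δ₁) / s) * frobSq X with hθ₁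
  set θ₂ : ℝ := φ * Real.sqrt (32 * φ ^ 2 * Real.log (2 / δ₂) / c) * frobSq X with hθ₂
  have hp := W.isOversampledDist_rowDist hX
  have hφ := W.pos hX
  have hF : 0 < frobSq X := frobSq_pos hX
  have hw0 : ∀ ω : Fin s → Fin m, 0 ≤ iidWeight p ω := iidWeight_nonneg hp.nonneg
  -- stage 1 events: `E₁` = key lemma for `S`, `G` = Lemma 2.14's good event
  let E₁ : (Fin s → Fin m) → Prop := fun ω =>
    Real.sqrt (frobSq ((sketch p ω * X)ᵀ * (sketch p ω * X) - Xᵀ * X)) < θ₁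
  let G : (Fin s → Fin m) → Prop := fun ω => frobSq X / 2 ≤ frobSq (sketch p ω * X)
  have hE₁ : 1 - δ₁ < ∑ ω ∈ univ.filter E₁, iidWeight p ω := by
    have hkey := approx_matrix_product' hp hp hφ hφ hX hX hs hδ₁
    have havg : (fun k => (p k + p k) / 2) = p := funext fun k => by ring
    rw [havg] at hkey
    have hthr' : Real.sqrt (8 * φ * φ * Real.log (2 / δ₁) / s) *
        (Real.sqrt (frobSq X) * Real.sqrt (frobSq X)) = θ₁ := by
      rw [hθ₁, Real.mul_self_sqrt (frobSq_nonneg X), show (8 : ℝ) * φ * φ = 8 * φ ^ 2 by ring]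
    rw [hthr'] at hkey
    exact hkey
  have hG : ∑ ω ∈ univ.filter (fun ω => ¬ G ω), iidWeight p ω ≤ δ₃ := by
    have h := iid_mass_frobSq_sketch_lt_half_le W hX hs hδ₃ hsδ
    refine le_of_eq_of_le (sum_congr ?_ fun _ _ => rfl) h
    ext ω; simp only [mem_filter, mem_univ, true_and, G, not_le, hpdef]
  have hEG : 1 - δ₁ - δ₃ < ∑ ω ∈ univ.filter (fun ω => E₁ ω ∧ G ω), iidWeight p ω := by
    have := sum_filter_and_ge'' univ (iidWeight p) hw0 E₁ G
    linarith
  -- the good event for `(ω, τ)`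
  let good : (Fin s → Fin m) → (Fin c → Fin n) → Prop := fun ω τ =>
    Real.sqrt (frobSq ((sketch p ω * X)ᵀ * (sketch p ω * X) - Xᵀ * X)) < θ₁ ∧
    Real.sqrt (frobSq ((sketch p ω * X) * (sketch p ω * X)ᵀ -
        (sketch (rowDist (sketch p ω * W.tilde)ᵀ) τ * (sketch p ω * X)ᵀ)ᵀ *
          (sketch (rowDist (sketch p ω * W.tilde)ᵀ) τ * (sketch p ω * X)ᵀ))) < θ₂ ∧
    frobSq (sketch p ω * X) ≤ φ * frobSq X
  -- stage 2: for every good `ω`, the `τ`-mass of the good outcomes exceeds `1 − δ₂`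
  have hstage2 : ∀ ω, E₁ ω ∧ G ω →
      1 - δ₂ < ∑ τ ∈ univ.filter (fun τ : Fin c → Fin n => good ω τ),
        iidWeight (rowDist (sketch p ω * W.tilde)ᵀ) τ := by
    rintro ω ⟨hωE, hωG⟩
    set R := sketch p ω * X with hRdef
    have hRpos : 0 < frobSq R := lt_of_lt_of_le (by linarith) hωG
    have hRne : R ≠ 0 := fun h0 => by
      rw [h0] at hRpos; simp [frobSq_eq_sum_sq] at hRpos
    have hRtne : Rᵀ ≠ 0 := fun h0 => hRne (by simpa using congrArg Matrix.transpose h0)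
    -- the witness `SQ_{φ_ω}((S_ωX)ᵀ)` of Lemma 2.14, with `φ_ω ≤ 2φ`
    let W₂ := (W.sketched ω hRne).transpose
    have hφω : sketchPhi W ω ≤ 2 * φ := sketchPhi_le_two_mul W hX ω hωG
    have hq : IsOversampledDist (2 * φ) (rowNorms Rᵀ) (rowDist (sketch p ω * W.tilde)ᵀ) := by
      have h := W₂.isOversampledDist_rowDist hRtne
      simp only [W₂, MatrixOversamplingWitness.transpose_tilde,
        MatrixOversamplingWitness.sketched_tilde] at h
      exact h.mono (W₂.pos hRtne) hφω
    have h2φ : 0 < 2 * φ := by linarith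
    have hkey := approx_matrix_product' hq hq h2φ h2φ hRtne hRtne hc hδ₂
    have havg : (fun k => (rowDist (sketch p ω * W.tilde)ᵀ k +
        rowDist (sketch p ω * W.tilde)ᵀ k) / 2) = rowDist (sketch p ω * W.tilde)ᵀ :=
      funext fun k => by ring
    rw [havg] at hkey
    -- the stage-2 threshold is at most `θ₂` since `‖Rᵀ‖_F² = ‖SX‖_F² ≤ φ‖X‖_F²`
    have hRle : frobSq R ≤ φ * frobSq X := frobSq_sketch_mul_le hp hφ ω
    have hRtle : frobSq Rᵀ ≤ φ * frobSq X := by rw [frobSq_transpose]; exact hRle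
    have hthr2 : Real.sqrt (8 * (2 * φ) * (2 * φ) * Real.log (2 / δ₂) / c) *
        (Real.sqrt (frobSq Rᵀ) * Real.sqrt (frobSq Rᵀ)) ≤ θ₂ := by
      rw [Real.mul_self_sqrt (frobSq_nonneg _), hθ₂,
        show (8 : ℝ) * (2 * φ) * (2 * φ) = 32 * φ ^ 2 by ring]
      calc Real.sqrt (32 * φ ^ 2 * Real.log (2 / δ₂) / c) * frobSq Rᵀ
          ≤ Real.sqrt (32 * φ ^ 2 * Real.log (2 / δ₂) / c) * (φ * frobSq X) :=
            mul_le_mul_of_nonneg_left hRtle (Real.sqrt_nonneg _)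
        _ = φ * Real.sqrt (32 * φ ^ 2 * Real.log (2 / δ₂) / c) * frobSq X := by ring
    refine lt_of_lt_of_le hkey (sum_le_sum_of_subset_of_nonneg ?_ fun τ _ _ =>
      iidWeight_nonneg hq.nonneg τ)
    intro τ hτ
    simp only [mem_filter, mem_univ, true_and] at hτ ⊢
    refine ⟨hωE, ?_, hRle⟩
    have hτ' := hτ
    simp only [Matrix.transpose_transpose] at hτ'
    rw [← frobSq_neg'', neg_sub]
    exact lt_of_lt_of_le hτ' hthr2
  -- assemble: total mass ≥ Σ_{ω ∈ E₁ ∩ G} w(ω) (1 − δ₂) ≥ (1 − δ₁ − δ₃)(1 − δ₂) ≥ 1 − δ₁ − δ₂ − δ₃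
  have hinner_nonneg : ∀ ω : Fin s → Fin m, 0 ≤ ∑ τ ∈ univ.filter (fun τ : Fin c → Fin n =>
      good ω τ), iidWeight (rowDist (sketch p ω * W.tilde)ᵀ) τ := fun ω =>
    sum_nonneg fun τ _ =>
      iidWeight_nonneg (fun k => div_nonneg (normSq_nonneg _) (frobSq_nonneg _)) τ
  show 1 - δ₁ - δ₂ - δ₃ < ∑ ω : Fin s → Fin m, iidWeight p ω *
      ∑ τ ∈ univ.filter (fun τ : Fin c → Fin n => good ω τ),
        iidWeight (rowDist (sketch p ω * W.tilde)ᵀ) τ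
  rcases le_or_gt 1 δ₂ with hδ₂1 | hδ₂1
  · calc 1 - δ₁ - δ₂ - δ₃ < 0 := by linarith
      _ ≤ _ := sum_nonneg fun ω _ => mul_nonneg (hw0 ω) (hinner_nonneg ω)
  calc 1 - δ₁ - δ₂ - δ₃ ≤ (1 - δ₁ - δ₃) * (1 - δ₂) := by
        have : 0 ≤ δ₂ * (δ₁ + δ₃) := by positivity
        nlinarith
    _ < (∑ ω ∈ univ.filter (fun ω => E₁ ω ∧ G ω), iidWeight p ω) * (1 - δ₂) :=
        mul_lt_mul_of_pos_right hEG (by linarith)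
    _ = ∑ ω ∈ univ.filter (fun ω => E₁ ω ∧ G ω), iidWeight p ω * (1 - δ₂) := by rw [sum_mul]
    _ ≤ ∑ ω ∈ univ.filter (fun ω => E₁ ω ∧ G ω), iidWeight p ω *
          ∑ τ ∈ univ.filter (fun τ : Fin c → Fin n => good ω τ),
            iidWeight (rowDist (sketch p ω * W.tilde)ᵀ) τ :=
        sum_le_sum fun ω hω => mul_le_mul_of_nonneg_left
          (hstage2 ω (by simpa only [mem_filter, mem_univ, true_and] using hω)).le (hw0 ω)
    _ ≤ _ := sum_le_sum_of_subset_of_nonneg (filter_subset _ _) fun ω _ _ =>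
          mul_nonneg (hw0 ω) (hinner_nonneg ω)

/-! ### On the good event: the eigenvalue estimates and every filtered eigenvector at once -/

/-- **Consequences on the good event (deterministic).**  If a sketch outcome `R = SX`,
`CCᵀ = (TRᵀ)ᵀ(TRᵀ)` satisfies `‖RᵀR − XᵀX‖_F < θ₁`, `‖RRᵀ − CCᵀ‖_F < θ₂`, `‖R‖_F² ≤ φ‖X‖_F²`, then
(a) the padded squared singular values of `C` are within `θ₂ + θ₁` of those of `X` in `ℓ²`
("Consider computing the eigenvalues of `CC†`; denote the `i`th eigenvalue `λ̂_i` … by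
(prop:appr-svs)"), hence index-wise and in top-`k` sum (`abs_sub_le_l2dist`,
`sum_abs_sub_le_sqrt_mul_l2dist`); and (b) for EVERY width `w > 0`, estimate `est > 2w`, and
indices `j₀`, `k₀` satisfying the gap/estimate/separation hypotheses of `pca_eigenvector_error`,
the explicit `v̂` satisfies
`min(‖v̂ − v_{j₀}‖², ‖v̂ + v_{j₀}‖²) ≤ 2(θ₁/w + φ‖X‖_F²((1/w)/a + 1/a²)θ₂)²`.
[cite: ChiaEtAl2022, §4.3 proof of Cor. 4.8] -/
theorem good_event_consequences (X : Matrix (Fin m) (Fin n) ℝ) (hX : (Xᵀ * X).IsHermitian)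
    {p : Fin m → ℝ} {q : Fin n → ℝ} (ω : Fin s → Fin m) (τ : Fin c → Fin n) {θ₁ θ₂ φ : ℝ}
    (h₁ : Real.sqrt (frobSq ((sketch p ω * X)ᵀ * (sketch p ω * X) - Xᵀ * X)) < θ₁)
    (h₂ : Real.sqrt (frobSq ((sketch p ω * X) * (sketch p ω * X)ᵀ -
        (sketch q τ * (sketch p ω * X)ᵀ)ᵀ * (sketch q τ * (sketch p ω * X)ᵀ))) < θ₂)
    (h₃ : frobSq (sketch p ω * X) ≤ φ * frobSq X) :
    (∀ N, n ≤ N → s ≤ N →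
      l2dist N (sqSingularValues (sketch q τ * (sketch p ω * X)ᵀ)ᵀ) (sqSingularValues X) <
        θ₂ + θ₁) ∧
    (∀ (w est : ℝ) (j₀ : Fin n) (k₀ : Fin s)
      (hC : ((sketch q τ * (sketch p ω * X)ᵀ)ᵀ * (sketch q τ * (sketch p ω * X)ᵀ)).IsHermitian),
      0 < w → 2 * w < est → |est - hX.eigenvalues j₀| ≤ w →
      (∀ j, j ≠ j₀ → 8 * w ≤ |hX.eigenvalues j - hX.eigenvalues j₀|) →
      (∀ k, k ≠ k₀ → 2 * w ≤ |hC.eigenvalues k - est|) →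
      min (normSq (Real.sqrt (bumpBar est w (hC.eigenvalues k₀)) •
              ((sketch p ω * X)ᵀ *ᵥ ⇑(hC.eigenvectorBasis k₀)) - ⇑(hX.eigenvectorBasis j₀)))
          (normSq (Real.sqrt (bumpBar est w (hC.eigenvalues k₀)) •
              ((sketch p ω * X)ᵀ *ᵥ ⇑(hC.eigenvectorBasis k₀)) + ⇑(hX.eigenvectorBasis j₀))) ≤
        2 * ((1 / w) * θ₁ +
          φ * frobSq X * (((1 / w) / (est - 2 * w) + 1 / (est - 2 * w) ^ 2) * θ₂)) ^ 2) := by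
  set R := sketch p ω * X with hR
  set B := sketch q τ * Rᵀ with hB
  refine ⟨fun N hNn hNs => ?_, fun w est j₀ k₀ hC hw hwe hest hsep hsepC => ?_⟩
  · have h := sqSingularValues_sketch_dist_le p ω q τ X hNn hNs
    have h₂' : Real.sqrt (frobSq (Bᵀ * B - Rᵀᵀ * Rᵀ)) < θ₂ := by
      rw [Matrix.transpose_transpose, ← frobSq_neg'', neg_sub]; exact h₂
    exact lt_of_le_of_lt h (add_lt_add h₂' h₁)
  · have ha : 0 < est - 2 * w := by linarith
    have hLb : 0 ≤ (1 / w) / (est - 2 * w) + 1 / (est - 2 * w) ^ 2 :=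
      add_nonneg (div_nonneg (by positivity) ha.le) (by positivity)
    have hcore := pca_eigenvector_error X hX R Bᵀ hC
      (by rw [Matrix.transpose_transpose]) j₀ k₀ hw hwe hest hsep hsepC
    refine hcore.trans (mul_le_mul_of_nonneg_left (pow_le_pow_left₀ ?_ ?_ 2) (by norm_num))
    · exact add_nonneg (mul_nonneg (by positivity) (Real.sqrt_nonneg _))
        (mul_nonneg (frobSq_nonneg R) (mul_nonneg hLb (Real.sqrt_nonneg _)))
    · refine add_le_add (mul_le_mul_of_nonneg_left h₁.le (by positivity)) ?_
      calc frobSq R * (((1 / w) / (est - 2 * w) + 1 / (est - 2 * w) ^ 2) *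
            Real.sqrt (frobSq (R * Rᵀ - Bᵀ * B)))
          ≤ frobSq R * (((1 / w) / (est - 2 * w) + 1 / (est - 2 * w) ^ 2) * θ₂) :=
            mul_le_mul_of_nonneg_left (mul_le_mul_of_nonneg_left h₂.le hLb) (frobSq_nonneg R)
        _ ≤ φ * frobSq X * (((1 / w) / (est - 2 * w) + 1 / (est - 2 * w) ^ 2) * θ₂) :=
            mul_le_mul_of_nonneg_right h₃ (mul_nonneg hLb ((Real.sqrt_nonneg _).trans h₂.le))

/-! ### Corollary 4.8 in the tree's two-stage-mass language -/

open Classical in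
/-- **Corollary 4.8 (low-rank PCA from `SQ_φ(X)`; Frobenius form, explicit constants, one
statement for all components).**  With `SQ_φ(X)` (`X ≠ 0`), `s, c ≥ 1`, `δ₁, δ₂, δ₃ > 0`,
`s ≥ 2φ² ln(1/δ₃)`, `θ₁ = √(8φ² log(2/δ₁)/s)‖X‖_F²`, `θ₂ = φ√(32φ² log(2/δ₂)/c)‖X‖_F²`: sampling the
row sketch `S_ω` (`R = S_ωX`) and then the column sketch `T_τ` of `R` (`C = RT_τᵀ`) as in
(thm:evenSing), with two-stage mass `> 1 − δ₁ − δ₂ − δ₃` BOTH (a) the eigenvalues of `CCᵀ` (padded,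
sorted: `sqSingularValues`) are within `θ₁ + θ₂` of those of `XᵀX` in `ℓ²` — whence
`Σ_{i<k}|λ̂_i − λ_i| ≤ √k(θ₁+θ₂)` and `|λ̂_i − λ_i| ≤ θ₁ + θ₂` (`sum_abs_sub_le_sqrt_mul_l2dist`,
`abs_sub_le_l2dist`) — AND (b) for every width `w > 0` (`= (η/8)‖X‖²`), every eigen-index `j₀` of
`XᵀX` that is `8w`-separated, every estimate `est > 2w` with `|est − λ_{j₀}| ≤ w` and every index
`k₀` such that the other eigenvalues of `CCᵀ` are `≥ 2w` off `est`, the explicit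
`v̂ = √(\bar f(μ_{k₀}))·Rᵀu_{k₀}` has
`min(‖v̂ − v_{j₀}‖², ‖v̂ + v_{j₀}‖²) ≤ 2(θ₁/w + φ‖X‖_F²((1/w)/a + 1/a²)θ₂)²` (`a = est − 2w`).
Reading off the paper's `r, c`: make the right-hand side `≤ ε²/2`.
[cite: ChiaEtAl2022, §4.3 Cor. 4.8 and its proof (pp. 25–26 of the held text)] -/
theorem low_rank_pca (W : MatrixOversamplingWitness φ X) (hX : X ≠ 0)
    (hXH : (Xᵀ * X).IsHermitian) (hs : 0 < s) (hc : 0 < c) {δ₁ δ₂ δ₃ : ℝ} (hδ₁ : 0 < δ₁)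
    (hδ₂ : 0 < δ₂) (hδ₃ : 0 < δ₃) (hsδ : 2 * φ ^ 2 * Real.log (1 / δ₃) ≤ s) :
    1 - δ₁ - δ₂ - δ₃ <
      ∑ ω : Fin s → Fin m, iidWeight (rowDist W.tilde) ω *
        ∑ τ ∈ univ.filter (fun τ : Fin c → Fin n =>
          (∀ N, n ≤ N → s ≤ N →
            l2dist N (sqSingularValues (sketch (rowDist (sketch (rowDist W.tilde) ω * W.tilde)ᵀ) τ *
                (sketch (rowDist W.tilde) ω * X)ᵀ)ᵀ) (sqSingularValues X) <
              φ * Real.sqrt (32 * φ ^ 2 * Real.log (2 / δ₂) / c) * frobSq X +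
                Real.sqrt (8 * φ ^ 2 * Real.log (2 / δ₁) / s) * frobSq X) ∧
          (∀ (w est : ℝ) (j₀ : Fin n) (k₀ : Fin s)
            (hC : ((sketch (rowDist (sketch (rowDist W.tilde) ω * W.tilde)ᵀ) τ *
                (sketch (rowDist W.tilde) ω * X)ᵀ)ᵀ *
              (sketch (rowDist (sketch (rowDist W.tilde) ω * W.tilde)ᵀ) τ *
                (sketch (rowDist W.tilde) ω * X)ᵀ)).IsHermitian),
            0 < w → 2 * w < est → |est - hXH.eigenvalues j₀| ≤ w →
            (∀ j, j ≠ j₀ → 8 * w ≤ |hXH.eigenvalues j - hXH.eigenvalues j₀|) →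
            (∀ k, k ≠ k₀ → 2 * w ≤ |hC.eigenvalues k - est|) →
            min (normSq (Real.sqrt (bumpBar est w (hC.eigenvalues k₀)) •
                  ((sketch (rowDist W.tilde) ω * X)ᵀ *ᵥ ⇑(hC.eigenvectorBasis k₀)) -
                  ⇑(hXH.eigenvectorBasis j₀)))
                (normSq (Real.sqrt (bumpBar est w (hC.eigenvalues k₀)) •
                  ((sketch (rowDist W.tilde) ω * X)ᵀ *ᵥ ⇑(hC.eigenvectorBasis k₀)) +
                  ⇑(hXH.eigenvectorBasis j₀))) ≤
              2 * ((1 / w) * (Real.sqrt (8 * φ ^ 2 * Real.log (2 / δ₁) / s) * frobSq X) +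
                φ * frobSq X * (((1 / w) / (est - 2 * w) + 1 / (est - 2 * w) ^ 2) *
                  (φ * Real.sqrt (32 * φ ^ 2 * Real.log (2 / δ₂) / c) * frobSq X))) ^ 2)),
          iidWeight (rowDist (sketch (rowDist W.tilde) ω * W.tilde)ᵀ) τ := by
  refine lt_of_lt_of_le (two_sketch_good_event W hX hs hc hδ₁ hδ₂ hδ₃ hsδ) ?_
  refine twoStage_mass_mono (W.isOversampledDist_rowDist hX).nonneg
    (fun ω k => div_nonneg (normSq_nonneg _) (frobSq_nonneg _)) fun ω τ hG => ?_
  exact good_event_consequences X hXH ω τ hG.1 hG.2.1 hG.2.2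

/-! ### The printed gap `η` (sorted spectrum) versus Mathlib's eigen-indexing -/

/-- **From the paper's gap to index separation.**  If `a₀ ≥ a₁ ≥ … ≥ a_{N−1}` (e.g. the sorted
squared singular values `sqSingularValues X`) has consecutive gaps `a_i − a_{i+1} ≥ g` for all
`i < k` (the printed `η‖X‖² = min_{i∈[k]} |λ_i − λ_{i+1}|`), then every index `i₀ < k` is
`g`-separated from every other index `j < N` — the hypothesis `hsep` of `cfc_bump_eq_vecMulVec`
with `g = 8w`. [cite: ChiaEtAl2022, §4.3 Problem 4.7 (definition of `η`) and proof of Cor. 4.8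
("From the eigenvalue gap …")] -/
theorem separated_of_consecutive_gaps (a : ℕ → ℝ) {N k i₀ : ℕ}
    (hanti : ∀ i j, i ≤ j → j < N → a j ≤ a i) (hi₀ : i₀ < k) (hk : k < N) {g : ℝ}
    (hgap : ∀ i, i < k → g ≤ a i - a (i + 1)) {j : ℕ} (hj : j < N) (hji : j ≠ i₀) :
    g ≤ |a j - a i₀| := by
  rcases lt_or_gt_of_ne hji with hlt | hgt
  · -- `j < i₀`: `a j ≥ a (i₀ − 1) ≥ a i₀ + g`
    obtain ⟨i, rfl⟩ : ∃ i, i₀ = i + 1 := ⟨i₀ - 1, by omega⟩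
    have h1 : a i ≤ a j := hanti j i (by omega) (by omega)
    have h2 : g ≤ a i - a (i + 1) := hgap i (by omega)
    exact le_trans (by linarith) (le_abs_self _)
  · -- `j > i₀`: `a j ≤ a (i₀ + 1) ≤ a i₀ − g`
    have h1 : a j ≤ a (i₀ + 1) := hanti (i₀ + 1) j (by omega) hj
    have h2 : g ≤ a i₀ - a (i₀ + 1) := hgap i₀ hi₀
    rw [abs_sub_comm]
    exact le_trans (by linarith) (le_abs_self _)

/-- **Mathlib's `eigenvalues` are the sorted `eigenvalues₀` re-indexed**: `λ (e i) = λ↓ i` for the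
canonical bijection `e : Fin (card ι) ≃ ι` (by definition of `Matrix.IsHermitian.eigenvalues`); so
`v_{e i}` (`eigenvectorBasis (e i)`) IS an eigenvector for the `i`-th largest eigenvalue, and a
separation hypothesis on the sorted spectrum transfers to the index `j₀ = e i₀`. [cite:
ChiaEtAl2022, §4.3 Problem 4.7 ("top `k` eigenvalues `{λ_i}` and eigenvectors `{v_i}`")] -/
theorem eigenvalues_equiv_eq {𝕜 : Type*} [RCLike 𝕜] {ι : Type*} [Fintype ι] [DecidableEq ι]
    {A : Matrix ι ι 𝕜} (hA : A.IsHermitian) (i : Fin (Fintype.card ι)) :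
    hA.eigenvalues (Fintype.equivOfCardEq (Fintype.card_fin _) i) = hA.eigenvalues₀ i := by
  simp [Matrix.IsHermitian.eigenvalues]

/-- Transfer of separation from the sorted spectrum to Mathlib's indexing: if `λ↓` is
`g`-separated at `i₀`, then `λ` is `g`-separated at `j₀ = e i₀`. [cite: ChiaEtAl2022, §4.3 proof
of Cor. 4.8 ("From the eigenvalue gap …")] -/
theorem sep_eigenvalues_of_sep_eigenvalues₀ {𝕜 : Type*} [RCLike 𝕜] {ι : Type*} [Fintype ι]
    [DecidableEq ι] {A : Matrix ι ι 𝕜} (hA : A.IsHermitian) (i₀ : Fin (Fintype.card ι)) {g : ℝ}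
    (hsep₀ : ∀ i, i ≠ i₀ → g ≤ |hA.eigenvalues₀ i - hA.eigenvalues₀ i₀|) :
    ∀ j, j ≠ Fintype.equivOfCardEq (Fintype.card_fin _) i₀ →
      g ≤ |hA.eigenvalues j - hA.eigenvalues (Fintype.equivOfCardEq (Fintype.card_fin _) i₀)| := by
  intro j hj
  set e := Fintype.equivOfCardEq (Fintype.card_fin (Fintype.card ι)) with he
  have hj' : e.symm j ≠ i₀ := fun h => hj (by rw [← h, Equiv.apply_symm_apply])
  have h := hsep₀ (e.symm j) hj'
  rwa [← eigenvalues_equiv_eq hA (e.symm j), ← eigenvalues_equiv_eq hA i₀,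
    Equiv.apply_symm_apply] at h

/-! ### "Finally, we can get access to `v̂_i = R†\bar v_i`": SQ access to the output -/

/-- `Rᵀ v̄ = Σ_t v̄_t R(t,·)` — the output is a linear combination of the `s` rows of `R`.
[cite: ChiaEtAl2022, §4.3 proof of Cor. 4.8 (last paragraph, "(lemma:sample-Mv)")] -/
theorem transpose_mulVec_eq_sum_smul (R : Matrix (Fin s) (Fin n) ℝ) (vbar : Fin s → ℝ) :
    Rᵀ *ᵥ vbar = ∑ t, vbar t • R t := by
  rw [Matrix.mulVec_transpose, Matrix.vecMul_eq_sum]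

/-- **`SQ_φ(v̂)` for `v̂ = Rᵀv̄`** (with exact `SQ` access to the rows of `R`, which are rescaled
rows of `X`): the tree's linear-combination lemma (`OversamplingWitness.linComb`, Tang 2019
Prop. 4.3 = CGLLTW's (lemma:sample-Mv)) gives the witness with
`φ = s·Σ_t ‖v̄_t R(t,·)‖² / ‖Σ_t v̄_t R(t,·)‖² = s·Σ_t v̄_t²‖R(t,·)‖²/‖Rᵀv̄‖²` — the printed
"`φ = r Σ_{s=1}^r v̂_i(s)²‖R(s,·)‖²/‖R†\bar v_i‖²`" [sic: `\bar v_i(s)` is meant; `v̂_i ∈ ℂⁿ` has no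
index `s ∈ [r]`]. [cite: ChiaEtAl2022, §4.3 proof of Cor. 4.8 (last display); TangEwin2019,
Prop. 4.3] -/
def outputWitness (R : Matrix (Fin s) (Fin n) ℝ) (vbar : Fin s → ℝ) (hne : ∑ t, vbar t • R t ≠ 0) :
    OversamplingWitness
      (s * (∑ t, (1 : ℝ) * normSq (vbar t • R t)) / normSq (∑ t, vbar t • R t))
      (∑ t, vbar t • R t) :=
  OversamplingWitness.linComb (fun t => OversamplingWitness.refl (R t)) vbar hne

/-- The oversampling factor of `outputWitness`, simplified: `φ = s·Σ_t v̄_t²‖R(t,·)‖²/‖Rᵀv̄‖²`.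
[cite: ChiaEtAl2022, §4.3 proof of Cor. 4.8 (last display)] -/
theorem outputWitness_phi_eq (R : Matrix (Fin s) (Fin n) ℝ) (vbar : Fin s → ℝ) :
    s * (∑ t, (1 : ℝ) * normSq (vbar t • R t)) / normSq (∑ t, vbar t • R t) =
      s * (∑ t, vbar t ^ 2 * normSq (R t)) / normSq (Rᵀ *ᵥ vbar) := by
  simp_rw [one_mul, normSq_smul, transpose_mulVec_eq_sum_smul]

end LowRankPCA

end SampleQuery

end Literature.Computability.QuantumComplexity
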